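import Summits.ValiantsHypothesis.ValiantsHypothesis.Theorems.SymPencilPerFourOneRowKernelPlane

/-!
# Route `SymPencil` — leaf R1N of the `(11, 5, 4)` cascade, §6.4: the PURE and the GRAPH kernel planes are
# impossible (`--supports` stmt-ValiantsHypothesis-5674 `SdcSuperquadratic`; memo `SING-FIVE-CLASSIFICATION.md` §6.4;
# branch lemmas for the residual `stub_threeRowsFourCols` / `stub_R1N_rankLeThree` of
# `Cruxes/SdcSuperquadratic/Lines/sing_five_classification.lean`; rung currency only)

Setting: one zero row `i`, live rows `r, s, t` (`{i,r,s,t} = Fin 4`), no zero column, row `r` of `W` of rank `3`,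
`dim W = 5`, `Sing3 W`; by `kernel_permOrth` + ✓ `perpPlanes` the kernel plane `K_r = W ∩ {row r = 0}` is PURE, GRAPH
or PRODUCT.  Lemma TwoRows enters as the HYPOTHESIS `hT1…` («no pure-`z` element ⇒ the rows `x, y` have a common zero
column», the in-file corollary (T1′) of the workfile's per-direction tool and ✓
`SymPencilPerFourTwoRowsCommonZeroColumn.common_zero_coord`).

* `pure_absurd` — PURE (`row s ≡ 0` on `K_r`) ⇒ `False`: no pure-`s` element, so rows `r, t` share a zero column `m`;
  row `r` of `W` is all of `e_m^⊥`; the `s¹`-reading `T3 (row y r) (row y s) b = 0` (`b` = row `t` of a kernel element)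
  is bordered, `y_{sm} · T3 (row y r) e_m b = 0`, and `y_{sm} ≢ 0` (no zero column), so `b = 0` and the kernel element
  vanishes — contradicting `dim K_r = 2`;
* `graph_absurd` — GRAPH ⇒ `False`: no pure element at all, so both pairs `(r,s)`, `(r,t)` have common zero columns
  `m₁, m₂`; `m₁ = m₂` is a zero column, `m₁ ≠ m₂` puts row `r` inside a `2`-dimensional coordinate subspace.

Honest framing: [folklore]; two of the four kernel-plane branches of ONE leaf (R1N) of ONE of four open size-27 cells
(PRODUCT = §6.5, toric = §6.6, rank-4 = §6.3 are separate); R1N and the cell file remain OPEN; `27 ≤ sdc(per₄) ≤ 29`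
unchanged; the crux `SdcSuperquadratic` and `VP ≠ VNP` untouched; no summit statement is proved here.  No definitions.
-/

noncomputable section

set_option linter.dupNamespace false

namespace Summit.ValiantsHypothesis.ValiantsHypothesis.Theorems.SymPencilPerFourOneRowKernelPlanePure

open Matrix Module MvPolynomial
open Literature.Computability.AlgebraicComplexity
open Summit.ValiantsHypothesis.ValiantsHypothesis.Theorems.SymPencilSingSixClassification
open Summit.ValiantsHypothesis.ValiantsHypothesis.Theorems.SymPencilPerFourOneRowKernelPlane

variable {K : Type*} [Field K]

/-! ## 4. The PURE kernel plane is impossible -/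

/-- The coordinate hyperplane `{z | z m = 0}` of `K⁴` has dimension `3`. [folklore] -/
theorem finrank_ker_proj (m : Fin 4) :
    finrank K (LinearMap.ker (LinearMap.proj m : (Fin 4 → K) →ₗ[K] K)) = 3 := by
  have h := LinearMap.finrank_range_add_finrank_ker (LinearMap.proj m : (Fin 4 → K) →ₗ[K] K)
  have hr : LinearMap.range (LinearMap.proj m : (Fin 4 → K) →ₗ[K] K) = ⊤ := by
    rw [LinearMap.range_eq_top]
    intro c
    exact ⟨Pi.single m c, by simp⟩
  rw [hr, finrank_top, Module.finrank_self, Module.finrank_fintype_fun_eq_card, Fintype.card_fin] at h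
  omega

/-- **PURE kernel plane ⇒ contradiction** (memo §6.4 PURE).  One zero row `i`, live rows `r, s, t`; row `r`
of `W` has rank `3`; the kernel plane `K_r = W ∩ {row r = 0}` has row `s ≡ 0` (it consists of pure-`t`
elements).  Then there is no pure-`s` element, so (Lemma TwoRows on the rows `r, t`, hypothesis `hT1`) rows
`r, t` have a common zero column `m`; no column of `W` vanishes, so `y ↦ y_{s m}` is not identically zero;
row `r` of `W` is all of `e_m^⊥`; the `s¹`-reading `T3 (row y r) (row y s) b = 0` (`b` = row `t` of a
non-zero kernel element) is bordered, `y_{sm} · T3 (row y r) e_m b = 0`, hence `T3 z e_m b = 0` for all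
`z ⊥ e_m`, hence `b = 0` — so the kernel element vanishes, contradicting `dim K_r = 2`. [folklore] -/
theorem pure_absurd [CharZero K] {W : Submodule K (Fin 4 × Fin 4 → K)} (hS : Sing3 W)
    (h5 : finrank K W = 5) {i r s t : Fin 4} (hrs : r ≠ s) (hrt : r ≠ t) (hst : s ≠ t)
    (hcov : ∀ x : Fin 4, x = i ∨ x = r ∨ x = s ∨ x = t)
    (hi : ∀ y ∈ W, row y i = 0)
    (hcol : ∀ m : Fin 4, ∃ y ∈ W, ∃ x : Fin 4, y (x, m) ≠ 0)
    (hnr : finrank K (W.map (rowL r)) = 3)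
    (hT1 : (∀ k ∈ W, row k r = 0 → row k t = 0 → k = 0) → ∃ m, ∀ y ∈ W, y (r, m) = 0 ∧ y (t, m) = 0)
    (hpure : ∀ k ∈ W, row k r = 0 → row k s = 0) : False := by
  classical
  -- no pure-`s` element
  have hg : ∀ k ∈ W, row k r = 0 → row k t = 0 → k = 0 := by
    intro k hk hkr hkt
    have hks := hpure k hk hkr
    funext ⟨x, m⟩
    rcases hcov x with rfl | rfl | rfl | rfl
    · exact congr_fun (hi k hk) m
    · exact congr_fun hkr m
    · exact congr_fun hks m
    · exact congr_fun hkt m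
  obtain ⟨m, hm⟩ := hT1 hg
  -- a witness of `y_{sm} ≢ 0`
  obtain ⟨y₀, hy₀, x, hx⟩ := hcol m
  have hy₀s : y₀ (s, m) ≠ 0 := by
    rcases hcov x with rfl | rfl | rfl | rfl
    · exact absurd (congr_fun (hi y₀ hy₀) m) hx
    · exact absurd (hm y₀ hy₀).1 hx
    · exact hx
    · exact absurd (hm y₀ hy₀).2 hx
  -- row `r` of `W` is the whole hyperplane `e_m^⊥`
  have hAr : ∀ z : Fin 4 → K, z m = 0 → ∃ y ∈ W, row y r = z := by
    have hle : W.map (rowL r) ≤ LinearMap.ker (LinearMap.proj m : (Fin 4 → K) →ₗ[K] K) := by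
      rintro _ ⟨y, hy, rfl⟩
      rw [LinearMap.mem_ker]
      exact (hm y hy).1
    have heq := Submodule.eq_of_le_of_finrank_eq hle (by rw [hnr, finrank_ker_proj])
    intro z hz
    have hz' : z ∈ W.map (rowL r) := by rw [heq, LinearMap.mem_ker]; exact hz
    obtain ⟨y, hy, hyz⟩ := Submodule.mem_map.1 hz'
    exact ⟨y, hy, hyz⟩
  -- a non-zero element of the kernel plane and its row `t`
  have hK2 : finrank K ↥(W ⊓ LinearMap.ker (rowL r)) = 2 := by
    have := finrank_kernel_add W r; omega
  have hKne : W ⊓ LinearMap.ker (rowL r) ≠ ⊥ := fun h => by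
    rw [h, finrank_bot] at hK2; omega
  obtain ⟨k, hk, hk0⟩ := Submodule.exists_mem_ne_zero_of_ne_bot hKne
  obtain ⟨hkW, hkr⟩ := mem_kernel_iff.1 hk
  have hbm : row k t m = 0 := (hm k hkW).2
  -- the `s¹`-reading and its bordered form
  have hread : ∀ y ∈ W, ∀ l, T3 (row y r) (row y s) (row k t) l = 0 := by
    intro y hy l
    have := polar₂ hS hrs hrt hst hy hkW hkr l
    rw [hpure k hkW hkr, T3_zero₂, zero_add] at this
    exact this
  have hprod : ∀ l, l ≠ m → ∀ y ∈ W, y (s, m) * T3 (row y r) (Pi.single m 1) (row k t) l = 0 := by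
    intro l hl y hy
    have h1 := hread y hy l
    rw [T3_border m l hl (row y r) (row y s) (row k t) (hm y hy).1 hbm] at h1
    exact h1
  have hz : ∀ l, l ≠ m → ∀ y ∈ W, T3 (row y r) (Pi.single m 1) (row k t) l = 0 := fun l hl =>
    vanish_of_mul_vanish W (fun y => y (s, m)) (fun y => T3 (row y r) (Pi.single m 1) (row k t) l)
      (fun _ _ => rfl) (fun a c => by rw [row_add, T3_add₁]) (hprod l hl) hy₀ hy₀s
  have hb0 : row k t = 0 := eq_zero_of_T3_border m (row k t) hbm fun z hz' l hl => by
    obtain ⟨y, hy, hyz⟩ := hAr z hz'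
    rw [← hyz]
    exact hz l hl y hy
  exact hk0 (hg k hkW hkr hb0)

/-! ## 5. The GRAPH kernel plane is impossible -/

/-- **GRAPH kernel plane ⇒ contradiction** (memo §6.4 GRAPH).  If `K_r` is a graph plane
`{(v ; e·σv)}` then it contains no pure element, so Lemma TwoRows applies to both pairs `(r, s)` and
`(r, t)`: common zero columns `m₁` (rows `r, s`) and `m₂` (rows `r, t`); `m₁ = m₂` is a zero column of `W`,
`m₁ ≠ m₂` puts row `r` of `W` inside a `2`-dimensional coordinate subspace, contradicting rank `3`. [folklore] -/
theorem graph_absurd {W : Submodule K (Fin 4 × Fin 4 → K)}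
    {i r s t : Fin 4} (hst : s ≠ t)
    (hcov : ∀ x : Fin 4, x = i ∨ x = r ∨ x = s ∨ x = t)
    (hi : ∀ y ∈ W, row y i = 0)
    (hcol : ∀ m : Fin 4, ∃ y ∈ W, ∃ x : Fin 4, y (x, m) ≠ 0)
    (hnr : finrank K (W.map (rowL r)) = 3)
    (hT1s : (∀ k ∈ W, row k r = 0 → row k s = 0 → k = 0) → ∃ m, ∀ y ∈ W, y (r, m) = 0 ∧ y (s, m) = 0)
    (hT1t : (∀ k ∈ W, row k r = 0 → row k t = 0 → k = 0) → ∃ m, ∀ y ∈ W, y (r, m) = 0 ∧ y (t, m) = 0)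
    (hgraph : ∃ (j c : Fin 4) (e : K), j ≠ c ∧ e ≠ 0 ∧
      ∀ d, d ∈ W ⊓ LinearMap.ker (rowL r) ↔ ((∀ x, x ≠ s → x ≠ t → row d x = 0) ∧
        (∀ x, x ≠ j → x ≠ c → d (s, x) = 0 ∧ d (t, x) = 0) ∧
        d (t, j) = e * d (s, j) ∧ d (t, c) = -(e * d (s, c)))) : False := by
  classical
  obtain ⟨j, c, e, hjc, he, hD⟩ := hgraph
  -- no pure elements
  have aux : ∀ k ∈ W, row k r = 0 → (∀ x, x ≠ j → x ≠ c → k (s, x) = 0 ∧ k (t, x) = 0) ∧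
      k (t, j) = e * k (s, j) ∧ k (t, c) = -(e * k (s, c)) := fun k hk hkr =>
    ((hD k).1 (mem_kernel_iff.2 ⟨hk, hkr⟩)).2
  have zero_of_rows : ∀ k ∈ W, row k r = 0 → row k s = 0 → row k t = 0 → k = 0 := by
    intro k hk hkr hks hkt
    funext ⟨x, m⟩
    rcases hcov x with rfl | rfl | rfl | rfl
    · exact congr_fun (hi k hk) m
    · exact congr_fun hkr m
    · exact congr_fun hks m
    · exact congr_fun hkt m
  have hgs : ∀ k ∈ W, row k r = 0 → row k t = 0 → k = 0 := by
    intro k hk hkr hkt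
    obtain ⟨hoff, hj, hc⟩ := aux k hk hkr
    refine zero_of_rows k hk hkr ?_ hkt
    funext x
    by_cases hxj : x = j
    · subst hxj
      have h1 : k (t, x) = 0 := congr_fun hkt x
      rw [h1] at hj
      exact (mul_eq_zero.1 hj.symm).resolve_left he
    by_cases hxc : x = c
    · subst hxc
      have h1 : k (t, x) = 0 := congr_fun hkt x
      rw [h1, eq_comm, neg_eq_zero] at hc
      exact (mul_eq_zero.1 hc).resolve_left he
    · exact (hoff x hxj hxc).1
  have hgt : ∀ k ∈ W, row k r = 0 → row k s = 0 → k = 0 := by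
    intro k hk hkr hks
    obtain ⟨hoff, hj, hc⟩ := aux k hk hkr
    refine zero_of_rows k hk hkr hks ?_
    funext x
    by_cases hxj : x = j
    · subst hxj
      have h1 : k (s, x) = 0 := congr_fun hks x
      rw [h1, mul_zero] at hj; exact hj
    by_cases hxc : x = c
    · subst hxc
      have h1 : k (s, x) = 0 := congr_fun hks x
      rw [h1, mul_zero, neg_zero] at hc; exact hc
    · exact (hoff x hxj hxc).2
  obtain ⟨m₁, hm₁⟩ := hT1s hgt
  obtain ⟨m₂, hm₂⟩ := hT1t hgs
  by_cases hmm : m₁ = m₂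
  · subst hmm
    obtain ⟨y₀, hy₀, x, hx⟩ := hcol m₁
    rcases hcov x with rfl | rfl | rfl | rfl
    · exact hx (congr_fun (hi y₀ hy₀) m₁)
    · exact hx (hm₁ y₀ hy₀).1
    · exact hx (hm₁ y₀ hy₀).2
    · exact hx (hm₂ y₀ hy₀).2
  · -- row `r` of `W` lies in `{z_{m₁} = z_{m₂} = 0}`, of dimension `2`
    let N : Submodule K (Fin 4 → K) :=
      LinearMap.ker (LinearMap.proj m₁ : (Fin 4 → K) →ₗ[K] K) ⊓ LinearMap.ker (LinearMap.proj m₂ : (Fin 4 → K) →ₗ[K] K)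
    have hle : W.map (rowL r) ≤ N := by
      rintro _ ⟨y, hy, rfl⟩
      exact Submodule.mem_inf.2 ⟨(hm₁ y hy).1, (hm₂ y hy).1⟩
    have hlt : N < LinearMap.ker (LinearMap.proj m₁ : (Fin 4 → K) →ₗ[K] K) := by
      refine lt_of_le_of_ne inf_le_left fun h => ?_
      have hmem : (Pi.single m₂ 1 : Fin 4 → K) ∈ LinearMap.ker (LinearMap.proj m₁ : (Fin 4 → K) →ₗ[K] K) := by
        rw [LinearMap.mem_ker]; simp [Ne.symm hmm]
      rw [← h] at hmem
      have := (Submodule.mem_inf.1 hmem).2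
      rw [LinearMap.mem_ker] at this
      simp at this
    have h1 := Submodule.finrank_lt_finrank_of_lt hlt
    have h2 := Submodule.finrank_mono hle
    rw [finrank_ker_proj] at h1
    omega

end Summit.ValiantsHypothesis.ValiantsHypothesis.Theorems.SymPencilPerFourOneRowKernelPlanePure

end
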